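import Summits.BirchSwinnertonDyer.BirchSwinnertonDyer.Theorems.GenusKolyvaginAtTwoEquivariantKolyvaginExactAtTwoKolyvaginPrimeDictionary
import Literature.NumberTheory.EllipticCurves.LocalRestrictionDegree
import Literature.NumberTheory.EllipticCurves.ArchimedeanLocalConditionTorsion
import Mathlib.Topology.Algebra.Valued.NormedValued
import HarnessLib

/-!
# Route `GenusKolyvaginAtTwo`, LINE 6, KEY crux Q3 (inner statement of stmt-BirchSwinnertonDyer-22137):
# the Selmer local condition descends `K → ℚ` at a place that SPLITS in `K` (`K_w = ℚ_v`) — McCallum's Lemma 4.3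
# over `ℚ` at the bad places `v ∣ N` (all split in `K` by the Heegner hypothesis) and at `2` when it splits

Helper (seat `bsd-line-gk2-p3` g12; `--supports` the crux, closes nothing). The transfers of this lineage so far
(`…SelmerDescentUnramified/Quadratic/Ramified`) need GOOD reduction at `v ∤ n` (the condition is then "unramified").
At the bad places of `E` and at the places dividing `n = 2^M` no such description exists; but when the place `v`
SPLITS in the quadratic field (`[K_w : ℚ_v] = 1`) the two local conditions simply coincide. This file proves it in
the tree's formalism:

* §1 (any `L/F`, any place, any `n`): `mem_selmerLocalKer_of_resTorsion_mem_of_finrank_eq_one` — **if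
  `[L_w : F_v] = 1` then `res x ∈ selmerLocalKer_w(E_L) ⟹ x ∈ selmerLocalKer_v(E)`**: the level-`n` condition is
  the preimage of the `H¹(·, E)` condition (`mem_selmerLocalKer_iff_torsionH1ToH1_mem`, `torsionH1ToH1_resTorsion`,
  `mem_localRestrictionKer_iff_resBaseChange_mem`), and a class dying over `L_w` dies over `F_v` up to the index
  `[Γ_{F_v} : Γ_{\tilde L_w}] = [L_w : F_v] = 1` (`index_nsmul_mem_localRestrictionKer_of_tower`);
* §2 (over `ℚ`, `K = ℚ(θ)`, `θ² = c ∈ ℤ`): `finrank_adicCompletion_eq_one_of_sq` — **if `c` is a square in `ℚ_v`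
  then `[K_w : ℚ_v] = 1`** (the image of `K = ℚ[θ]` lies in the closed line `ℚ_v · 1 ∋ ±√c`, and is dense);
  `mem_selmerLocalKer_of_resTorsion_mem_quadratic_of_sq` — the transfer at such `v`, with NO hypothesis on the
  reduction of `E` at `v` nor on `v ∤ n`.

Reading for the crux (pair descent at `2` over `ℚ`): the residual ℚ-level Lemma-4.3 inputs of `…VisiblePairInputReductions`
at `v ∣ N` are discharged from the `K`-statement (every `v ∣ N` splits in `K`: Heegner hypothesis, `d_K` a non-zero
square mod `v`, Hensel), and at `v = 2` when `d_K ≡ 1 (mod 8)`; what remains over `ℚ` is `v = 2` inert, the twin at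
`v ∣ d_K`, and the DEF primes. THEOREMS ONLY (no definition, no named fact, no `sorry`, standard axioms). BSD is not
proved by any of this.

References: [McCallumLMS1991] §4 Lemma 4.3; [GrossLMS1991] §3 (3.1) (Heegner hypothesis), Prop. 6.2 (1);
[SerreGaloisCohomology1997] I §2.4; [SerreLocalFields1979] II §3.
-/

set_option autoImplicit false
set_option linter.dupNamespace false -- tree convention: `Summit.BirchSwinnertonDyer.BirchSwinnertonDyer.Theorems` (summit = sub-problem)

noncomputable section

open scoped Classical

universe u

namespace Summit.BirchSwinnertonDyer.BirchSwinnertonDyer.Theorems.GenusExact.SelmerDescent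

open WeierstrassCurve NumberField IsDedekindDomain Field
open Literature.NumberTheory.EllipticCurves Literature.NumberTheory.GaloisRepresentations

/-! ## §1 Degree-one completions: the local conditions coincide -/

section General

variable {F : Type u} [Field F] [NumberField F] (W : WeierstrassCurve F) [W.IsElliptic]
variable (L : Type u) [Field L] [NumberField L] [Algebra F L]
variable (v : HeightOneSpectrum (𝓞 F)) (w : HeightOneSpectrum (𝓞 L)) [w.asIdeal.LiesOver v.asIdeal]

omit [W.IsElliptic] in
/-- **If `[L_w : F_v] = 1` then `res x ∈ selmerLocalKer_w(E_L) ⟹ x ∈ selmerLocalKer_v(E)`**, for any `n : ℤ` and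
any finite place `v` (good or bad, dividing `n` or not). [cite: McCallumLMS1991, §4 Lemma 4.3]
[cite: SerreGaloisCohomology1997, I §2.4 (Cor. to Prop. 9)] -/
theorem mem_selmerLocalKer_of_resTorsion_mem_of_finrank_eq_one (n : ℤ)
    (h1 : letI : Algebra (v.adicCompletion F) (w.adicCompletion L) :=
        (adicCompletionMap (K := F) L v w).toAlgebra
      Module.finrank (v.adicCompletion F) (w.adicCompletion L) = 1)
    {x : galH1Torsion W n}
    (hx : resTorsion W L n x ∈ selmerLocalKer (W.baseChange L) (w.adicCompletion L) n) :
    x ∈ selmerLocalKer W (v.adicCompletion F) n := by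
  letI : Algebra (v.adicCompletion F) (w.adicCompletion L) := (adicCompletionMap (K := F) L v w).toAlgebra
  obtain ⟨hfin, -⟩ := finrank_adicCompletion_le_of_liesOver L v w
  haveI : FiniteDimensional (v.adicCompletion F) (w.adicCompletion L) := hfin
  haveI : IsScalarTower F (v.adicCompletion F) (w.adicCompletion L) :=
    IsScalarTower.of_algebraMap_eq fun x ↦ (adicCompletionMap_coe (K := F) L v w x).symm
  haveI : CharZero (v.adicCompletion F) :=
    charZero_of_injective_algebraMap (algebraMap F (v.adicCompletion F)).injective
  rw [mem_selmerLocalKer_iff_torsionH1ToH1_mem]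
  rw [mem_selmerLocalKer_iff_torsionH1ToH1_mem, torsionH1ToH1_resTorsion] at hx
  have hx' : torsionH1ToH1 W n x ∈ W.localRestrictionKer (w.adicCompletion L) :=
    (mem_localRestrictionKer_iff_resBaseChange_mem W _).mpr hx
  have h := index_nsmul_mem_localRestrictionKer_of_tower W (E := v.adicCompletion F) hx'
  have hidx : (finGalSubgroup (E := v.adicCompletion F) (w.adicCompletion L)).index = 1 := by
    haveI : IsGalois (v.adicCompletion F) (w.adicCompletion L) :=
      isGalois_of_finrank_le_two (E := v.adicCompletion F) (w.adicCompletion L) (by omega)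
    rw [index_finGalSubgroup_eq, finrank_finGaloisClosure_eq, h1]
  rwa [hidx, one_nsmul] at h

end General

/-! ## §2 Over `ℚ`: a place where `c` is a square has `[K_w : ℚ_v] = 1` -/

section Rat

open scoped Valued

variable {K : Type} [Field K] [NumberField K]

/-- **`[K_w : ℚ_v] = 1` at a place where `c` is a square in `ℚ_v`** (`K = ℚ(θ)` quadratic, `θ² = c ∈ ℤ`, `w ∣ v`):
the closed line `ℚ_v · 1 ⊆ K_w` contains `θ = ±√c` hence the dense image of `K = ℚ[θ]`. [cite: SerreLocalFields1979, II §3]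
[cite: NeukirchANT1999, Ch. II Prop. (8.3)] -/
theorem finrank_adicCompletion_eq_one_of_sq (h2 : Module.finrank ℚ K = 2) {θ : K}
    (hθ : θ ∉ (algebraMap ℚ K).range) {c : ℤ} (hc : θ ^ 2 = algebraMap ℚ K c)
    (v : HeightOneSpectrum (𝓞 ℚ)) (w : HeightOneSpectrum (𝓞 K)) [w.asIdeal.LiesOver v.asIdeal]
    (hs : ∃ s : v.adicCompletion ℚ, s ^ 2 = algebraMap ℚ (v.adicCompletion ℚ) c) :
    letI : Algebra (v.adicCompletion ℚ) (w.adicCompletion K) := (adicCompletionMap (K := ℚ) K v w).toAlgebra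
    Module.finrank (v.adicCompletion ℚ) (w.adicCompletion K) = 1 := by
  letI : Algebra (v.adicCompletion ℚ) (w.adicCompletion K) := (adicCompletionMap (K := ℚ) K v w).toAlgebra
  obtain ⟨hfin, -⟩ := finrank_adicCompletion_le_of_liesOver K v w
  haveI : FiniteDimensional (v.adicCompletion ℚ) (w.adicCompletion K) := hfin
  have hcoe : ∀ x : ℚ, adicCompletionMap (K := ℚ) K v w (algebraMap ℚ (v.adicCompletion ℚ) x) =
      algebraMap K (w.adicCompletion K) (algebraMap ℚ K x) := fun x ↦ adicCompletionMap_coe (K := ℚ) K v w x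
  haveI : IsScalarTower ℚ (v.adicCompletion ℚ) (w.adicCompletion K) :=
    IsScalarTower.of_algebraMap_eq fun x ↦ (hcoe x).symm
  haveI : ContinuousSMul (v.adicCompletion ℚ) (w.adicCompletion K) :=
    ⟨((continuous_adicCompletionMap (K := ℚ) K v w).comp continuous_fst).mul continuous_snd⟩
  set S : Set (w.adicCompletion K) := Set.range (algebraMap (v.adicCompletion ℚ) (w.adicCompletion K))
    with hSdef
  -- the image of `K` lies in `S = ℚ_v · 1`
  have hsub : Set.range (algebraMap K (w.adicCompletion K)) ⊆ S := by
    obtain ⟨s, hs⟩ := hs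
    let B : Subalgebra (v.adicCompletion ℚ) (w.adicCompletion K) := ⊥
    have hBS : ∀ y, y ∈ B ↔ y ∈ S := fun y ↦ by
      rw [hSdef, ← Algebra.coe_bot]; rfl
    let A : Subalgebra ℚ K :=
      { carrier := {l | algebraMap K (w.adicCompletion K) l ∈ B}
        mul_mem' := fun {a b} ha hb => by
          change algebraMap K _ (a * b) ∈ B
          rw [map_mul]; exact B.mul_mem ha hb
        one_mem' := by change algebraMap K _ 1 ∈ B; rw [map_one]; exact B.one_mem
        add_mem' := fun {a b} ha hb => by
          change algebraMap K _ (a + b) ∈ B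
          rw [map_add]; exact B.add_mem ha hb
        zero_mem' := by change algebraMap K _ 0 ∈ B; rw [map_zero]; exact B.zero_mem
        algebraMap_mem' := fun q => by
          change algebraMap K (w.adicCompletion K) (algebraMap ℚ K q) ∈ B
          rw [← hcoe, hBS]
          exact ⟨algebraMap ℚ _ q, rfl⟩ }
    have hθw : (algebraMap K (w.adicCompletion K) θ) ^ 2 =
        (algebraMap (v.adicCompletion ℚ) (w.adicCompletion K) s) ^ 2 := by
      rw [← map_pow, hc, ← hcoe, RingHom.algebraMap_toAlgebra, ← map_pow, hs]
    have hθB : θ ∈ A := by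
      change algebraMap K (w.adicCompletion K) θ ∈ B
      rcases sq_eq_sq_iff_eq_or_eq_neg.mp hθw with h | h
      · rw [h, hBS]; exact ⟨s, rfl⟩
      · rw [h]; exact B.neg_mem ((hBS _).mpr ⟨s, rfl⟩)
    have hA : A = ⊤ :=
      top_le_iff.mp ((adjoin_simple_eq_top_of_finrank_eq_two h2 hθ).symm.le.trans
        (Algebra.adjoin_le (Set.singleton_subset_iff.mpr hθB)))
    rintro _ ⟨l, rfl⟩
    have hl : l ∈ A := by rw [hA]; exact Algebra.mem_top
    exact (hBS _).mp hl
  -- `S` is closed (a finite-dimensional subspace) and the image of `K` is dense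
  have hclosed : IsClosed S := by
    have h := (LinearMap.range (Algebra.linearMap (v.adicCompletion ℚ) (w.adicCompletion K))).closed_of_finiteDimensional
    rwa [LinearMap.coe_range, Algebra.coe_linearMap] at h
  have hdense : DenseRange (algebraMap K (w.adicCompletion K)) := w.denseRange_algebraMap K
  have hS : S = Set.univ := by
    refine Set.eq_univ_of_forall fun y ↦ ?_
    have hy : y ∈ closure (Set.range (algebraMap K (w.adicCompletion K))) := by
      rw [hdense.closure_range]; exact Set.mem_univ y
    exact hclosed.closure_subset_iff.mpr hsub hy
  have hBtop : (⊥ : Subalgebra (v.adicCompletion ℚ) (w.adicCompletion K)) = ⊤ :=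
    SetLike.coe_injective (by rw [Algebra.coe_bot, Algebra.coe_top]; exact hS)
  exact Subalgebra.bot_eq_top_iff_finrank_eq_one.mp hBtop

variable (W : WeierstrassCurve ℚ) [W.IsElliptic]

omit [W.IsElliptic] in
/-- **McCallum's Lemma 4.3 transported from `K = ℚ(√c)` to `ℚ` at a place where `c` is a square in `ℚ_v`** (the
places SPLIT in `K` — for the Heegner field every `v ∣ N`; also `v = 2` when `c ≡ 1 (mod 8)`): for any `n : ℤ` and
`x ∈ H¹(ℚ, E[n])`, `res x ∈ selmerLocalKer_w(E_K) ⟹ x ∈ selmerLocalKer_v(E)`, with no hypothesis on the reduction of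
`E` at `v` or on `v ∤ n`. [cite: McCallumLMS1991, §4 Lemma 4.3] [cite: GrossLMS1991, §3 (3.1) and Prop. 6.2 (1)] -/
theorem mem_selmerLocalKer_of_resTorsion_mem_quadratic_of_sq (h2 : Module.finrank ℚ K = 2) {θ : K}
    (hθ : θ ∉ (algebraMap ℚ K).range) {c : ℤ} (hc : θ ^ 2 = algebraMap ℚ K c) (n : ℤ)
    (v : HeightOneSpectrum (𝓞 ℚ)) (w : HeightOneSpectrum (𝓞 K)) [w.asIdeal.LiesOver v.asIdeal]
    (hs : ∃ s : v.adicCompletion ℚ, s ^ 2 = algebraMap ℚ (v.adicCompletion ℚ) c)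
    {x : galH1Torsion W n} (hx : resTorsion W K n x ∈ selmerLocalKer (W.baseChange K) (w.adicCompletion K) n) :
    x ∈ selmerLocalKer W (v.adicCompletion ℚ) n :=
  mem_selmerLocalKer_of_resTorsion_mem_of_finrank_eq_one W K v w n
    (finrank_adicCompletion_eq_one_of_sq h2 hθ hc v w hs) hx

end Rat

end Summit.BirchSwinnertonDyer.BirchSwinnertonDyer.Theorems.GenusExact.SelmerDescent

end
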